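import Summits.AtomisticToContinuum.HydrodynamicLimit.Theorems.RelayRaceLocalityNearConstantShortTimeHLPositionLDReduction
import Summits.AtomisticToContinuum.HydrodynamicLimit.Theorems.RelayRaceLocalityNearConstantShortTimeHLCellsMeetingBall
import HarnessLib

/-!
# Crux `NearConstantShortTimeHL` (stmt-AtomisticToContinuum-12502), line `small-tilt-domination`, skeleton v14 (lead c7):
# the GRID LEMMAS of the net reduction `MesoscaleDensityLD ⇐ BallTiltLogLaplace`

Support file (`--supports stmt-AtomisticToContinuum-12502`) for the registered skeleton stub `stub_densityLD_of_ballTilt`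
(`…DensityLDOfBallTilt`): the envelope `Σ_j k⁻³ ballKernel ℓ (y_j) · ≤ 2` of a cell selection (`cells_meeting_ball_card_le`), the mass
`((k⁻¹)³)^{k³}` and the support of the product of the cell measures, the joint measurability of the centred ball average and of its
capped square, and the eventual regime of an admissible family used by the reduction. Elementary. References: folklore.
-/

noncomputable section

namespace Summit.AtomisticToContinuum.HydrodynamicLimit.Theorems.NearConstantShortTimeHL

open scoped BigOperators ENNReal
open MeasureTheory Set Filter Topology
open Literature.MathematicalPhysics.KineticTheory Literature.Analysis.FluidPDE Literature.Analysis.FunctionSpaces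

/-! ## The grid: envelope of the cell-selection tilts, mass and support of the product of the cell measures -/

/-- **Envelope of a cell selection**: if `y_j ∈ cell j` for all `j` (mesh `1/k`, `kℓ ≥ 10`, `ℓ + 2/k < 1/2`) then
`Σ_j k⁻³ ballKernel ℓ (y_j) x ≤ 2` for every `x` (the cells met by the ball of radius `ℓ` about `x` lie in the ball of radius
`ℓ + 2/k`, `cells_meeting_ball_card_le`; `(1 + 2/(kℓ))³ ≤ 1.2³ < 2`). [folklore] -/
theorem dn_envelope {k : ℕ} (hk : 0 < k) {ℓ : ℝ} (hℓ0 : 0 < ℓ) (hkℓ : 10 ≤ (k : ℝ) * ℓ) (hhalf : ℓ + 2 / k < 1 / 2)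
    (ys : (Fin 3 → Fin k) → T3) (hys : ∀ j, Torus.gridIndex k (Torus.repr (ys j)) = Torus.finIndex j) (x : T3) :
    ∑ j, ((k : ℝ) ^ 3)⁻¹ * ballKernel ℓ (ys j) x ≤ 2 := by
  have hk' : (0 : ℝ) < k := Nat.cast_pos.2 hk
  have hV : (0 : ℝ) < 4 / 3 * Real.pi * ℓ ^ 3 := by positivity
  have hsum : ∑ j, ((k : ℝ) ^ 3)⁻¹ * ballKernel ℓ (ys j) x = ((k : ℝ) ^ 3)⁻¹ * ((4 / 3 * Real.pi * ℓ ^ 3)⁻¹ *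
      ((Finset.univ.filter fun j => Torus.euclidDist (ys j) x < ℓ).card : ℝ)) := by
    rw [← Finset.mul_sum]
    congr 1
    simp only [ballKernel]
    rw [Finset.sum_ite, Finset.sum_const_zero, add_zero, Finset.sum_const, nsmul_eq_mul, mul_comm]
  have hcard := cells_meeting_ball_card_le hk hℓ0 hhalf x ys hys
  rw [hsum]
  have hratio : ℓ + 2 / k ≤ 6 / 5 * ℓ := by
    have h2k : 2 / (k : ℝ) ≤ ℓ / 5 := by
      rw [div_le_iff₀ hk']; nlinarith
    linarith
  calc ((k : ℝ) ^ 3)⁻¹ * ((4 / 3 * Real.pi * ℓ ^ 3)⁻¹ * ((Finset.univ.filter fun j => Torus.euclidDist (ys j) x < ℓ).card : ℝ))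
      ≤ ((k : ℝ) ^ 3)⁻¹ * ((4 / 3 * Real.pi * ℓ ^ 3)⁻¹ * ((k : ℝ) ^ 3 * (4 / 3 * Real.pi * (ℓ + 2 / k) ^ 3))) := by gcongr
    _ = ((ℓ + 2 / k) / ℓ) ^ 3 := by field_simp
    _ ≤ ((6 / 5 * ℓ) / ℓ) ^ 3 := by gcongr
    _ = (6 / 5) ^ 3 := by rw [mul_div_assoc, div_self hℓ0.ne', mul_one]
    _ ≤ 2 := by norm_num

/-- The product of the cell measures: its total mass is `((k⁻¹)³)^{k³}`. [folklore] -/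
theorem dn_pi_univ {k : ℕ} (hk : 0 < k) :
    Measure.pi (fun j : Fin 3 → Fin k => (volume : Measure T3).restrict
      {y : T3 | Torus.gridIndex k (Torus.repr y) = Torus.finIndex j}) univ = (((k : ℝ≥0∞)⁻¹) ^ 3) ^ (k ^ 3) := by
  rw [Measure.pi_univ]
  simp only [Measure.restrict_apply_univ, volume_cell hk]
  rw [Finset.prod_const, Finset.card_univ, Fintype.card_fun, Fintype.card_fin, Fintype.card_fin]

/-- The product of the cell measures is carried by the selections `y_j ∈ cell j`. [folklore] -/
theorem dn_pi_ae_mem {k : ℕ} (hk : 0 < k) :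
    ∀ᵐ ys ∂Measure.pi (fun j : Fin 3 → Fin k => (volume : Measure T3).restrict
      {y : T3 | Torus.gridIndex k (Torus.repr y) = Torus.finIndex j}),
      ∀ j, Torus.gridIndex k (Torus.repr (ys j)) = Torus.finIndex j := by
  rw [← Measure.restrict_pi_pi]
  filter_upwards [ae_restrict_mem (MeasurableSet.univ_pi fun j => measurableSet_cell hk j)] with ys hys
  exact fun j => hys j (mem_univ j)

/-! ## Measurability of the deviation -/

/-- The centred ball average `(x, y) ↦ m⁻¹ Σᵢ ballKernel ℓ y xᵢ − ρ₁(y)` is jointly measurable. [folklore] -/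
theorem dn_measurable_dev : ∀ {m : ℕ} (ℓ : ℝ) {ρ₁ : T3 → ℝ}, Measurable ρ₁ → Measurable fun p : (Fin m → T3) × T3 => (m : ℝ)⁻¹ * ∑ i, ballKernel ℓ p.2 (p.1 i) - ρ₁ p.2 :=
  fun ℓ _ hρ => ((Finset.measurable_sum _ fun i _ => wg_measurable_ballKernel measurable_snd
    ((measurable_pi_apply i).comp measurable_fst) ℓ).const_mul _).sub (hρ.comp measurable_snd)

/-- The capped squared deviation `(x, y) ↦ min 1 (m⁻¹ Σᵢ ballKernel ℓ y xᵢ − ρ₁(y))²` is jointly measurable. [folklore] -/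
theorem dn_measurable_capped {m : ℕ} (ℓ : ℝ) {ρ₁ : T3 → ℝ} (hρ : Measurable ρ₁) :
    Measurable fun p : (Fin m → T3) × T3 => min 1 (((m : ℝ)⁻¹ * ∑ i, ballKernel ℓ p.2 (p.1 i) - ρ₁ p.2) ^ 2) :=
  measurable_const.min ((dn_measurable_dev ℓ hρ).pow_const 2)

/-! ## The eventual regime -/

/-- **Eventual regime of the reduction** along an admissible family: `n ≥ 1`, `0 < ℓ ≤ 1`, `ε ≤ 2ℓ`, `13ℓ < 1/2`, `nε³ ≥ σ³/2`,
`ℓ⁴ = n⁻¹`, and the two smallness conditions `2γ′Mℓ ≤ κ/6`, `1331 ℓ log(4q+1) ≤ κ/6` (`ℓ → 0`). [folklore] -/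
theorem dn_eventually {ε : ℕ → ℝ} {n : ℕ → ℕ} {σ : ℝ} (hσ : 0 < σ) (hε : ∀ N, 0 < ε N)
    (hε0 : Tendsto ε atTop (𝓝 0)) (hnε : Tendsto (fun N => (n N : ℝ) * ε N ^ 3) atTop (𝓝 (σ ^ 3)))
    (A B : ℝ) {κ : ℝ} (hκ : 0 < κ) :
    ∀ᶠ N in atTop, 0 < n N ∧ 0 < mesoRadius (n N) ∧ mesoRadius (n N) ≤ 1 ∧ ε N ≤ 2 * mesoRadius (n N) ∧
      13 * mesoRadius (n N) < 1 / 2 ∧ σ ^ 3 / 2 ≤ (n N : ℝ) * ε N ^ 3 ∧ mesoRadius (n N) ^ 4 = ((n N : ℝ))⁻¹ ∧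
      A * mesoRadius (n N) ≤ κ / 6 ∧ B * mesoRadius (n N) ≤ κ / 6 := by
  have hn_top : Tendsto n atTop atTop := tendsto_atTop_of_tendsto_mul_pow_three hσ hε hε0 hnε
  have hℓ : Tendsto (fun N => mesoRadius (n N)) atTop (𝓝 0) := by
    unfold mesoRadius
    exact (tendsto_rpow_neg_atTop (by norm_num : (0 : ℝ) < 1 / 4)).comp (tendsto_natCast_atTop_atTop.comp hn_top)
  have hA : ∀ᶠ N in atTop, A * mesoRadius (n N) ≤ κ / 6 := by
    have h := hℓ.const_mul A
    rw [mul_zero] at h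
    exact h.eventually_le_const (by positivity)
  have hB : ∀ᶠ N in atTop, B * mesoRadius (n N) ≤ κ / 6 := by
    have h := hℓ.const_mul B
    rw [mul_zero] at h
    exact h.eventually_le_const (by positivity)
  filter_upwards [pd_eventually hσ hε hε0 hnε 0 one_pos, hℓ.eventually_le_const one_pos, hA, hB] with N h1 h2 hA hB
  obtain ⟨hn0, hℓ0, hεℓ, h13, hmε, -⟩ := h1
  have hn0' : (0 : ℝ) < n N := Nat.cast_pos.2 hn0
  have hℓ4 : mesoRadius (n N) ^ 4 = ((n N : ℝ))⁻¹ := by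
    unfold mesoRadius
    rw [← Real.rpow_natCast, ← Real.rpow_mul hn0'.le]
    norm_num
    exact Real.rpow_neg_one _
  exact ⟨hn0, hℓ0, h2, hεℓ, h13, hmε, hℓ4, hA, hB⟩

end Summit.AtomisticToContinuum.HydrodynamicLimit.Theorems.NearConstantShortTimeHL

end
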